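import Mathlib
import HarnessLib
import Summits.Langlands.Langlands.Theses.EvenSkinnerWilesMirror
import Summits.Langlands.Langlands.Theorems.EvenSkinnerWilesMirrorMirrorEntryTransport
import Literature.NumberTheory.GaloisRepresentations.ToLocalRestrictField
import Literature.NumberTheory.GaloisRepresentations.LocalKroneckerWeberInertiaProofs
import Literature.NumberTheory.GaloisRepresentations.InducedAEUnramified

/-!
# `EvenSkinnerWilesMirror.MirrorEntry` — proof of the crux (item `stmt-Langlands-15310`, file 2/2)

**Statement** (route `EvenSkinnerWilesMirror`, crux `MirrorEntry`, rank 3): let `p` be an odd prime,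
`O` the valuation ring of `ℚ̄_p`, and `ρ : Γ_ℚ → GL₂(ℚ̄_p)` continuous, irreducible, EVEN,
unramified almost everywhere, with an upper-triangular integral model `ρ₀ : Γ_ℚ → GL₂(O)`
(`ρ₀ ↦ ρ`, `ρ₀ mod 𝔪` upper triangular) which at the place `p` is `p`-distinguished and ordinary
of some even weight `k ≥ 2` up to `m`-th powers (an ordinary frame `Q`, `v(Q₀₀) ≤ v(Q₁₀)`, in
which the decomposition group is upper triangular with `a₁₁^m = 1`, `a₀₀^m = ε^{(k-1)m}` on
inertia).  Then for every totally complex quadratic field `K` in which `p` splits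
(`N(w) = p`, `w² ∤ (p)` for all `w ∣ p`) the restriction `ρ|_{Γ_K}` carries the same data: it is
irreducible, unramified almost everywhere, has the integral model `ρ₀' = ρ₀|_{Γ_K}`, and at every
`w ∣ p` it is `p`-distinguished and ordinary of weight `k` up to `m`-th powers.
Closing theorem (by name): `mirrorEntry_proof`.

**Proof.**  Take `ρ₀' = ρ₀ ∘ res_{K/ℚ}`.
* *Irreducible*: `isIrreducible_restrictField_of_isEven` (file 1): by Clifford theory a reducible
  `ρ|_{Γ_K}` would make `ρ ≅ ρ ⊗ χ_K`, i.e. `ρ` induced from the imaginary quadratic `K`; but an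
  even `ρ` has `ρ(c) = ±1` central while `χ_K(c) = -1` — absurd.  (Lens «special vs generic»: the
  special = induced locus is empty for even `ρ`.)
* *Unramified a.e.*: tree `FramedGaloisRep.eventually_isUnramifiedAt_restrictField`.
* *Integral model*: tautological (`ρ₀' ↦ ρ|_{Γ_K}`, same matrices).
* *At `w ∣ p`* (`local_transport`): `w` has degree one, so the local base change `ℚ_p → K_w` is an
  isomorphism and `res : Γ_{K_w} → Γ_{ℚ_p}` is onto (`absGaloisRestrict_adicCompletion_surjective`);
  the two routes `Γ_{K_w} → Γ_K → Γ_ℚ` and `Γ_{K_w} → Γ_{ℚ_p} → Γ_ℚ` differ by an inner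
  automorphism `int(τ)` of `Γ_ℚ` (tree `exists_absGaloisRestrict_adicCompletion_eq_conj`).  Hence
  `(ρ|_{Γ_K})|_{Γ_{K_w}} = ρ(τ) · ρ|_{Γ_{ℚ_p}} ∘ res · ρ(τ)⁻¹`: the frame `Q' = ρ(τ) Q` is again
  ordinary-oriented (`ρ(τ) = ρ₀(τ)` is integral and upper triangular mod `𝔪`; `v_mul_frame_le`),
  conjugating by it gives the old triangular shape at `res σ`, inertia maps to inertia
  (`absGaloisRestrict_mem_absInertia`) and `ε_{ℚ_p}(res σ) = ε_{K_w}(σ)`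
  (`cyclotomicCharacter_absGaloisRestrict`); `p`-distinguishedness transfers because `res` is onto
  and the residual diagonal characters are class functions (`residualDiag_conj`).
No conjecture or named fact is used; no definition is introduced.
Ref: Serre, *Abelian ℓ-adic representations* (1968), Ch. I §2.1; Skinner–Wiles, Publ. IHÉS 89
(1999), §1 and §4.6 (the shape of the hypotheses); Calegari, *Even Galois representations and the
Fontaine–Mazur conjecture* II, JAMS 25 (2012) (restriction of even `ρ` to imaginary quadratic
fields).  (decomp-langlands lens-2, g30.)
-/

set_option linter.dupNamespace false -- project-wide option (lakefile weak.linter.dupNamespace); `Summit.Langlands.Langlands` is the mandated namespace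

noncomputable section

namespace Summit.Langlands.Langlands.Theorems.EvenSkinnerWilesMirrorMirrorEntry

open Field NumberField IsDedekindDomain
open Literature.NumberTheory.GaloisRepresentations Literature.NumberTheory.Automorphic

section Local

variable {p : ℕ} [Fact p.Prime] {O : ValuationSubring (PadicAlgCl p)}
  {K : Type} [Field K] [NumberField K]

/-- **Transport of the local data at `p` along a place of degree one.**  For `w ∣ v` with
`e(w|v) = f(w|v) = 1`, an integral model `ρ₀ ↦ ρ` that is upper triangular mod `𝔪`,
`p`-distinguished at `v`, and an ordinary frame `Q` for `ρ|_{Γ_{ℚ_v}}` (weight `k`, exponent `m`),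
the restriction `ρ₀ ∘ res_{K/ℚ}` is `p`-distinguished at `w` and `ρ(τ) Q` is an ordinary frame for
`(ρ|_{Γ_K})|_{Γ_{K_w}}` with the same `k`, `m` — where `int(τ)` intertwines the two routes
`Γ_{K_w} → Γ_ℚ`. [folklore] -/
theorem local_transport
    (hO : O = (Valued.v : Valuation (PadicAlgCl p) NNReal).valuationSubring)
    (ρ : FramedGaloisRep ℚ (PadicAlgCl p) 2) (ρ₀ : absoluteGaloisGroup ℚ →* GL (Fin 2) O)
    (hmod : ρ.HasUpperTriangularIntegralModel ρ₀) (k m : ℕ) (v : HeightOneSpectrum (𝓞 ℚ))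
    (w : HeightOneSpectrum (𝓞 K)) [w.asIdeal.LiesOver v.asIdeal]
    (he : w.asIdeal.ramificationIdx (𝓞 ℚ) = 1) (hf : w.asIdeal.inertiaDeg (𝓞 ℚ) = 1)
    (hdist : IsPDistinguishedAt ρ₀ v) (Q : GL (Fin 2) (PadicAlgCl p))
    (hQle : Valued.v (Q.val 0 0) ≤ Valued.v (Q.val 1 0))
    (hQ : ∀ σ, (Q⁻¹ * ρ.toLocal v σ * Q).val 1 0 = 0 ∧
      (σ ∈ absInertia (v.adicCompletion ℚ) → (Q⁻¹ * ρ.toLocal v σ * Q).val 1 1 ^ m = 1 ∧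
        (Q⁻¹ * ρ.toLocal v σ * Q).val 0 0 ^ m = algebraMap (Padic p) (PadicAlgCl p)
          (((GaloisRep.cyclotomicCharacter (v.adicCompletion ℚ) p σ).val : PadicInt p) : Padic p) ^
            ((k - 1) * m))) :
    IsPDistinguishedAt (ρ₀.comp (absGaloisRestrict ℚ K).toMonoidHom) w ∧
      ∃ Q' : GL (Fin 2) (PadicAlgCl p), Valued.v (Q'.val 0 0) ≤ Valued.v (Q'.val 1 0) ∧
        ∀ σ, (Q'⁻¹ * (ρ.restrictField K).toLocal w σ * Q').val 1 0 = 0 ∧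
          (σ ∈ absInertia (w.adicCompletion K) →
            (Q'⁻¹ * (ρ.restrictField K).toLocal w σ * Q').val 1 1 ^ m = 1 ∧
            (Q'⁻¹ * (ρ.restrictField K).toLocal w σ * Q').val 0 0 ^ m =
              algebraMap (Padic p) (PadicAlgCl p)
                (((GaloisRep.cyclotomicCharacter (w.adicCompletion K) p σ).val : PadicInt p) :
                  Padic p) ^ ((k - 1) * m)) := by
  letI := (adicCompletionOfLiesOver ℚ K v w).toAlgebra
  obtain ⟨τ, hτ⟩ := exists_absGaloisRestrict_adicCompletion_eq_conj v w
  have hsurj : Function.Surjective (absGaloisRestrict (v.adicCompletion ℚ) (w.adicCompletion K)) :=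
    absGaloisRestrict_adicCompletion_surjective K v w he hf
  -- the representation along the two routes `Γ_{K_w} → Γ_ℚ`
  have hrep : ∀ σ, (ρ.restrictField K).toLocal w σ =
      ρ τ * ρ.toLocal v (absGaloisRestrict (v.adicCompletion ℚ) (w.adicCompletion K) σ) * (ρ τ)⁻¹ := by
    intro σ
    rw [FramedGaloisRep.toLocal_apply, FramedGaloisRep.restrictField_apply, hτ σ, map_mul, map_mul,
      map_inv, FramedGaloisRep.toLocal_apply]
  refine ⟨?_, ρ τ * Q, ?_, fun σ => ?_⟩
  · -- `p`-distinguished: pull a distinguishing `σ'` back along the surjection, conjugate by `τ`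
    obtain ⟨σ', hσ'⟩ := hdist
    obtain ⟨σ, rfl⟩ := hsurj σ'
    refine ⟨σ, ?_⟩
    change residualDiag ρ₀ 0 (absGaloisRestrict ℚ K (absGaloisRestrict K (w.adicCompletion K) σ)) ≠
      residualDiag ρ₀ 1 (absGaloisRestrict ℚ K (absGaloisRestrict K (w.adicCompletion K) σ))
    rw [hτ σ, residualDiag_conj hmod.2, residualDiag_conj hmod.2]
    exact hσ'
  · -- the new frame is ordinary-oriented
    rw [← hmod.1 τ]
    exact v_mul_frame_le hO (ρ₀ τ) (hmod.2 τ 1 0 (by decide)) Q hQle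
  · have hconj : (ρ τ * Q)⁻¹ * (ρ.restrictField K).toLocal w σ * (ρ τ * Q) =
        Q⁻¹ * ρ.toLocal v (absGaloisRestrict (v.adicCompletion ℚ) (w.adicCompletion K) σ) * Q := by
      rw [hrep σ]
      group
    rw [hconj]
    obtain ⟨h10, hin⟩ := hQ (absGaloisRestrict (v.adicCompletion ℚ) (w.adicCompletion K) σ)
    refine ⟨h10, fun hσ => ?_⟩
    obtain ⟨h11, h00⟩ := hin (absGaloisRestrict_mem_absInertia K v w σ hσ)
    refine ⟨h11, ?_⟩
    haveI : CharZero (v.adicCompletion ℚ) :=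
      charZero_of_injective_algebraMap (algebraMap ℚ (v.adicCompletion ℚ)).injective
    haveI : NeZero (p : v.adicCompletion ℚ) := ⟨Nat.cast_ne_zero.mpr (Fact.out : p.Prime).ne_zero⟩
    rw [h00, cyclotomicCharacter_absGaloisRestrict]

end Local

/-- **`EvenSkinnerWilesMirror.MirrorEntry` holds** (item `stmt-Langlands-15310`, proved outright):
the Skinner–Wiles entry data of an even, irreducible, a.e. unramified, residually reducible
`p`-ordinary `p`-distinguished `ρ : Γ_ℚ → GL₂(ℚ̄_p)` pass to `ρ|_{Γ_K}` for every totally complex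
quadratic `K` in which `p` splits, with the integral model `ρ₀|_{Γ_K}` and the same `k`, `m`.
[folklore] -/
theorem mirrorEntry_proof : Summit.Langlands.Langlands.Theses.EvenSkinnerWilesMirror.MirrorEntry := by
  intro p _ hp2 O hO ρ ρ₀ hirr heven hunr hmod hloc K _ _ hKc hK2 hsplit
  obtain ⟨k, hk2, -, m, hm, hv⟩ := hloc
  refine ⟨ρ₀.comp (absGaloisRestrict ℚ K).toMonoidHom,
    isIrreducible_restrictField_of_isEven ρ hirr heven K hKc hK2,
    ρ.eventually_isUnramifiedAt_restrictField hunr,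
    ⟨fun g => hmod.1 _, fun g i j hij => hmod.2 _ i j hij⟩, k, hk2, m, hm, fun w hw => ?_⟩
  haveI : w.asIdeal.LiesOver (w.under (𝓞 ℚ)).asIdeal := liesOver_under w
  have hp : p.Prime := Fact.out
  have hpv : ((p : ℕ) : 𝓞 ℚ) ∈ (w.under (𝓞 ℚ)).asIdeal :=
    (natCast_mem_asIdeal_iff_of_liesOver (w.under (𝓞 ℚ)) w p).mp hw
  obtain ⟨hdist, Q, hQle, hQ⟩ := hv (w.under (𝓞 ℚ)) hpv
  obtain ⟨hcard, hsq⟩ := hsplit w hw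
  exact local_transport hO ρ ρ₀ hmod k m (w.under (𝓞 ℚ)) w
    (ramificationIdx_eq_one_of_not_sq_dvd w hp hw hsq)
    (inertiaDeg_eq_one_of_residueCard_eq w hp hw hcard) hdist Q hQle hQ

end Summit.Langlands.Langlands.Theorems.EvenSkinnerWilesMirrorMirrorEntry

end
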